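import Mathlib.NumberTheory.SumTwoSquares
import Mathlib.NumberTheory.LegendreSymbol.Basic
import Mathlib.GroupTheory.SpecificGroups.Cyclic.Basic
import Literature.NumberTheory.Automorphic.BrandtModuleSplitLattices
import Summits.BirchSwinnertonDyer.BirchSwinnertonDyer.Theorems.RamifiedHeegnerPairLeafPartnerBrandtNormFormThue
import HarnessLib

/-!
# Route `RamifiedHeegnerPair`, crux U₁ `LeafRankOneUpperAtThree` (stmt-BirchSwinnertonDyer-26022), line `partnerdescent` —
# input (C4) of the (G3♭ˢ) derivation: corner lines of `M₂(𝔽_ℓ)`-modules and norm-`ℓ` elements of `ℤ[u]`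
# (the abstract half of the fixed-point exclusion on Brandt sets)

HONEST FRAMING. Theorems only; helper file (`--supports stmt-BirchSwinnertonDyer-26022 --as helper`); elementary algebra over the
tree's residually-split dictionary (`LatQuot`, `actQ`, `subOf` of `BrandtModuleSplitLattices.lean`; `IsMatrixUnitAction`, `corner`,
`IsStable` of `BrandtModuleMatrixUnits.lean`) and Mathlib; no named fact, no `sorry`; nothing booked; BSD is proved for no curve.
Lead prover bsd-line-rhp-p2 g62, 2026-08-31 (memo `Cruxes/LeafRankOneUpperAtThree/LEAD-G61-G3-CORE.md` §7–§8). Companion (and import) of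
‹…LeafPartnerBrandtFixedPoint›, which assembles the fixed-point exclusion «a unit `u ≠ ±1` of `O_L(I_k)` fixes no counted sub-ideal
`J = αI_i ⊆ I_k` of prime index-square `ℓ²`, `[I_i] ≠ [I_k]`» from the four bricks below.

WHAT.
* §1 Corner transport: an endomorphism `L` of a right `M₂`-module `V` (matrix units `E, U, W`) commuting with the units maps corners to
  corners; the corner of `L(V)` is `L(Ve)`; `L(V)` is stable; `L = 0` on `Ve` forces `L = 0` (Peirce decomposition).
* §2 Lines in a plane: in a subgroup `G` of order `ℓ²` with a line `T` (order `ℓ`), two `G`-preserving endomorphisms `ψ, ψ'` with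
  `ψ'ψ = 0` on `G`, `ψ' = 0` on `T`, neither zero on `G`, satisfy `ψ(G) = T` (`map_eq_of_comp_eq_zero`); an endomorphism preserving a
  subgroup of prime order acts on it by an integer scalar `λ` (`exists_eq_smul_of_card_eq_prime`), and `φ² = tφ − 1` there forces
  `ℓ ∣ λ² − tλ + 1` (`dvd_of_eigenvalue`).
* §3 Arithmetic: for `t ∈ {0, ±1}` and a root `λ` of `x² − tx + 1` modulo the prime `ℓ` there are integers with `a² + tab + b² = ℓ` and
  `ℓ ∣ a + b(t − λ)` (two squares, Mathlib `Nat.Prime.sq_add_sq`; `a² ± ab + b²`, ‹…NormFormThue›; conjugate if necessary).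
* §4 Left multiplications `x ↦ zx` descend to `M/K` (`exists_latQuot_mulLeft`), commute with the right action (`actQ_mulLeft_comm`), and
  `βM/K` is the image of `M/K` (`subOf_units_smul_eq_map_top`).
[cite: Eichler1973, Ch. II §6 Thm. 2 (proof: ideals between `I` and `pI` via `M₂(ℤ/p)`-modules)] [cite: HardyWright2008, §20.4 Thm. 366–367]
-/

set_option linter.dupNamespace false
set_option autoImplicit false

noncomputable section

open scoped Pointwise

namespace Summit.BirchSwinnertonDyer.BirchSwinnertonDyer.Theorems.LeafPartnerBrandt

open Literature.NumberTheory.Automorphic Literature.NumberTheory.Automorphic.Brandt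
open Literature.NumberTheory.Automorphic.IsMatrixUnitAction

/-! ## 1. Corner transport under an endomorphism commuting with the matrix units -/

section Corner

variable {V : Type*} [AddCommGroup V] {E U W : V →+ V}

/-- An endomorphism `L` commuting with `E` maps the corner of an `L`-stable subgroup into itself. [folklore] -/
theorem apply_mem_corner_of_comm (L : V →+ V) (hE : ∀ y, E (L y) = L (E y)) {S : AddSubgroup V}
    (hLS : ∀ x ∈ S, L x ∈ S) {x : V} (hx : x ∈ corner E S) : L x ∈ corner E S :=
  ⟨hLS x hx.1, by rw [hE, hx.2]⟩

/-- The corner of the image `L(V)` is the image of the corner `Ve`, for `L` commuting with `E`. [folklore] -/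
theorem corner_map_top_eq_map_corner (h : IsMatrixUnitAction E U W) (L : V →+ V) (hE : ∀ y, E (L y) = L (E y)) :
    corner E ((⊤ : AddSubgroup V).map L) = (corner E ⊤).map L := by
  ext y
  rw [mem_corner, AddSubgroup.mem_map, AddSubgroup.mem_map]
  constructor
  · rintro ⟨⟨x, -, rfl⟩, hy⟩
    exact ⟨E x, ⟨AddSubgroup.mem_top _, h.ee x⟩, by rw [← hE, hy]⟩
  · rintro ⟨x, ⟨-, hx⟩, rfl⟩
    exact ⟨⟨x, AddSubgroup.mem_top _, rfl⟩, by rw [hE, hx]⟩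

/-- The image `L(V)` of an endomorphism commuting with the three matrix units is a stable subgroup. [folklore] -/
theorem isStable_map_top (L : V →+ V) (hE : ∀ y, E (L y) = L (E y)) (hU : ∀ y, U (L y) = L (U y))
    (hW : ∀ y, W (L y) = L (W y)) : IsStable E U W ((⊤ : AddSubgroup V).map L) := by
  rintro y ⟨x, -, rfl⟩
  exact ⟨⟨E x, AddSubgroup.mem_top _, (hE x).symm⟩, ⟨U x, AddSubgroup.mem_top _, (hU x).symm⟩,
    ⟨W x, AddSubgroup.mem_top _, (hW x).symm⟩⟩

/-- An endomorphism commuting with `E` and `U` that kills the corner `Ve` kills `V` (Peirce: `x = xe + (xv)u`). [folklore] -/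
theorem eq_zero_of_forall_corner_eq_zero (h : IsMatrixUnitAction E U W) (L : V →+ V)
    (hU : ∀ y, U (L y) = L (U y)) (h0 : ∀ x ∈ corner E (⊤ : AddSubgroup V), L x = 0) (y : V) : L y = 0 := by
  rw [h.decomp y, map_add, ← hU, h0 (E y) ⟨AddSubgroup.mem_top _, h.ee y⟩,
    h0 (W y) ⟨AddSubgroup.mem_top _, h.we y⟩, map_zero, add_zero]

end Corner

/-! ## 2. Lines in a plane: subgroups of order `ℓ` inside a group of order `ℓ²` -/

section Rank

variable {V : Type*} [AddCommGroup V] {ℓ : ℕ}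

/-- **Rank count.** In a subgroup `G` of order `ℓ²` (`ℓ` prime) let `T ≤ G` have order `ℓ`, and let `ψ, ψ'` be endomorphisms
preserving `G` with `ψ' ∘ ψ = 0` on `G`, `ψ' = 0` on `T`, and neither `ψ` nor `ψ'` zero on `G`. Then `ψ(G) = T`
(`ψ(G) ⊆ ker ψ'|_G = T`, a line, and `ψ(G) ≠ 0`). [folklore] -/
theorem map_eq_of_comp_eq_zero (hℓ : ℓ.Prime) {G T : AddSubgroup V} (hG : Nat.card G = ℓ ^ 2)
    (hT : Nat.card T = ℓ) (hTG : T ≤ G) {ψ ψ' : V →+ V} (hψG : ∀ x ∈ G, ψ x ∈ G)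
    (hcomp : ∀ x ∈ G, ψ' (ψ x) = 0) (hT0 : ∀ x ∈ T, ψ' x = 0) (hψ : ∃ x ∈ G, ψ x ≠ 0)
    (hψ' : ∃ x ∈ G, ψ' x ≠ 0) : G.map ψ = T := by
  haveI : Fact ℓ.Prime := ⟨hℓ⟩
  haveI : Finite G := Nat.finite_of_card_ne_zero (by rw [hG]; exact pow_ne_zero 2 hℓ.ne_zero)
  -- the kernel of `ψ'` on `G`
  set Kr : AddSubgroup V := G ⊓ ψ'.ker with hKr
  have hKrG : Kr ≤ G := inf_le_left
  haveI : Finite Kr := Finite.of_injective _ (AddSubgroup.inclusion_injective hKrG)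
  have hTKr : T ≤ Kr := fun x hx => ⟨hTG hx, (AddMonoidHom.mem_ker).mpr (hT0 x hx)⟩
  have hKr_ne : Kr ≠ G := by
    intro h
    obtain ⟨x, hxG, hx⟩ := hψ'
    have hx' : x ∈ Kr := h ▸ hxG
    exact hx ((AddMonoidHom.mem_ker).mp hx'.2)
  have hKr_card : Nat.card Kr = ℓ := by
    have hdvd : Nat.card Kr ∣ ℓ ^ 2 := hG ▸ AddSubgroup.card_dvd_of_le hKrG
    obtain ⟨i, hi2, hi⟩ := (Nat.dvd_prime_pow hℓ).mp hdvd
    have hle : ℓ ≤ Nat.card Kr := hT ▸ AddSubgroup.card_le_of_le hTKr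
    have hlt : Nat.card Kr < ℓ ^ 2 := by
      refine lt_of_le_of_ne (hG ▸ AddSubgroup.card_le_of_le hKrG) fun h => hKr_ne ?_
      exact AddSubgroup.eq_of_le_of_card_ge hKrG (by rw [h, hG])
    rw [hi] at hle hlt ⊢
    have hi1 : 1 ≤ i := by
      by_contra h0
      push Not at h0
      interval_cases i
      rw [pow_zero] at hle
      exact absurd hle (not_le.mpr hℓ.one_lt)
    have hi2' : i < 2 := (Nat.pow_lt_pow_iff_right hℓ.one_lt).mp hlt
    interval_cases i
    rw [pow_one]
  have hKrT : Kr = T := (AddSubgroup.eq_of_le_of_card_ge hTKr (by rw [hKr_card, hT])).symm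
  -- the image of `ψ` on `G`
  have hIm_le : G.map ψ ≤ Kr := by
    rintro y ⟨x, hx, rfl⟩
    exact ⟨hψG x hx, (AddMonoidHom.mem_ker).mpr (hcomp x hx)⟩
  rw [hKrT] at hIm_le
  haveI : Finite T := Nat.finite_of_card_ne_zero (by rw [hT]; exact hℓ.ne_zero)
  have hdvd : Nat.card (G.map ψ) ∣ ℓ := hT ▸ AddSubgroup.card_dvd_of_le hIm_le
  rcases (Nat.dvd_prime hℓ).mp hdvd with h1 | hℓ'
  · exfalso
    obtain ⟨x, hxG, hx⟩ := hψ
    have hbot : G.map ψ = ⊥ := AddSubgroup.eq_bot_of_card_eq _ h1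
    exact hx ((AddSubgroup.mem_bot).mp (hbot ▸ AddSubgroup.mem_map_of_mem ψ hxG))
  · exact AddSubgroup.eq_of_le_of_card_ge hIm_le (by rw [hℓ', hT])

/-- **An endomorphism preserving a subgroup of prime order acts on it by an integer scalar** (the subgroup is cyclic). [folklore] -/
theorem exists_eq_smul_of_card_eq_prime (hℓ : ℓ.Prime) {T : AddSubgroup V} (hT : Nat.card T = ℓ) {φ : V →+ V}
    (hφ : ∀ x ∈ T, φ x ∈ T) : ∃ lam : ℤ, ∀ x ∈ T, φ x = lam • x := by
  haveI : Fact ℓ.Prime := ⟨hℓ⟩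
  haveI : Finite T := Nat.finite_of_card_ne_zero (by rw [hT]; exact hℓ.ne_zero)
  haveI : Nontrivial T := Finite.one_lt_card_iff_nontrivial.mp (by rw [hT]; exact hℓ.one_lt)
  obtain ⟨g, hg⟩ := exists_ne (0 : T)
  obtain ⟨lam, hlam⟩ := (AddSubgroup.mem_zmultiples_iff).mp
    (mem_zmultiples_of_prime_card hT hg (g' := ⟨φ g, hφ _ g.2⟩))
  refine ⟨lam, fun x hx => ?_⟩
  obtain ⟨m, hm⟩ := (AddSubgroup.mem_zmultiples_iff).mp (mem_zmultiples_of_prime_card hT hg (g' := ⟨x, hx⟩))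
  have hm' : (m • (g : V)) = x := by simpa using congrArg Subtype.val hm
  have hlam' : (lam • (g : V)) = φ g := by simpa using congrArg Subtype.val hlam
  rw [← hm', map_zsmul, ← hlam', smul_smul, smul_smul, mul_comm]

/-- **The eigenvalue is a root of the minimal polynomial modulo `ℓ`**: if `φ² = tφ − 1` on a subgroup `T` of prime order `ℓ`
on which `φ` acts by the scalar `λ`, then `ℓ ∣ λ² − tλ + 1`. [folklore] -/
theorem dvd_of_eigenvalue (hℓ : ℓ.Prime) {T : AddSubgroup V} (hT : Nat.card T = ℓ) {φ : V →+ V} {t lam : ℤ}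
    (hrel : ∀ x ∈ T, φ (φ x) = t • φ x - x) (hlam : ∀ x ∈ T, φ x = lam • x) :
    (ℓ : ℤ) ∣ lam ^ 2 - t * lam + 1 := by
  haveI : Fact ℓ.Prime := ⟨hℓ⟩
  haveI : Finite T := Nat.finite_of_card_ne_zero (by rw [hT]; exact hℓ.ne_zero)
  haveI : Nontrivial T := Finite.one_lt_card_iff_nontrivial.mp (by rw [hT]; exact hℓ.one_lt)
  obtain ⟨g, hg⟩ := exists_ne (0 : T)
  have hord : addOrderOf g = ℓ := by
    have h := addOrderOf_dvd_natCard g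
    rw [hT] at h
    rcases (Nat.dvd_prime hℓ).mp h with h1 | h1
    · exact absurd (AddMonoid.addOrderOf_eq_one_iff.mp h1) hg
    · exact h1
  have hzero : (lam ^ 2 - t * lam + 1) • (g : V) = 0 := by
    have h1 := hrel g g.2
    rw [hlam g g.2, map_zsmul, hlam g g.2, smul_smul, smul_smul] at h1
    rw [add_smul, sub_smul, one_smul, pow_two, h1, mul_comm t lam]
    abel
  have hzero' : (lam ^ 2 - t * lam + 1) • g = 0 := Subtype.ext (by simpa using hzero)
  have h := (addOrderOf_dvd_iff_zsmul_eq_zero).mpr hzero'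
  rwa [hord] at h

end Rank

/-! ## 3. Arithmetic: a norm-`ℓ` element of `ℤ[u]` in the prescribed prime above `ℓ` -/

section Arith

/-- **Norm-`ℓ` elements of `ℤ[u]`, `u² = tu − 1`, `t ∈ {0, ±1}`.** If `x² − tx + 1` has a root `λ` modulo the prime `ℓ`, then
`ℓ = a² + tab + b²` for some integers `a, b` (two squares for `t = 0`: Mathlib `Nat.Prime.sq_add_sq`; `a² ± ab + b²` for `t = ±1`:
‹…NormFormThue›), and the pair may be chosen with `ℓ ∣ a + b(t − λ)` (replace `π = a + bu` by its conjugate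
`(a + tb) − bu` if necessary: `(a + b(t − λ))(a + bλ) = ℓ − b²(λ² − tλ + 1)`). [cite: HardyWright2008, §20.4 Thm. 366–367] -/
theorem exists_norm_eq_prime_and_dvd {t : ℤ} (ht : t = -1 ∨ t = 0 ∨ t = 1) {ℓ : ℕ} (hℓ : ℓ.Prime) {lam : ℤ}
    (hlam : (ℓ : ℤ) ∣ lam ^ 2 - t * lam + 1) :
    ∃ a b : ℤ, a ^ 2 + t * a * b + b ^ 2 = ℓ ∧ (ℓ : ℤ) ∣ a + b * (t - lam) := by
  haveI : Fact ℓ.Prime := ⟨hℓ⟩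
  -- Step 1: some pair with `a² + tab + b² = ℓ`
  have h1 : ∃ a b : ℤ, a ^ 2 + t * a * b + b ^ 2 = ℓ := by
    rcases ht with rfl | rfl | rfl
    · -- `t = -1`: `ℓ ∣ λ² + λ + 1`
      obtain ⟨a, b, hab⟩ := exists_sq_add_mul_add_sq_eq_of_dvd hℓ (x := lam) (by convert hlam using 1; ring)
      exact ⟨a, -b, by rw [← hab]; ring⟩
    · -- `t = 0`: `ℓ ∣ λ² + 1`, so `−1` is a square mod `ℓ` and `ℓ = a² + b²`
      have hsq : IsSquare (-1 : ZMod ℓ) := by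
        refine ⟨(lam : ZMod ℓ), ?_⟩
        have h0 : ((lam ^ 2 - 0 * lam + 1 : ℤ) : ZMod ℓ) = 0 := (ZMod.intCast_zmod_eq_zero_iff_dvd _ ℓ).mpr hlam
        push_cast at h0
        linear_combination -h0
      obtain ⟨a, b, hab⟩ := Nat.Prime.sq_add_sq (ZMod.exists_sq_eq_neg_one_iff.mp hsq)
      exact ⟨a, b, by rw [← hab]; push_cast; ring⟩
    · -- `t = 1`: `ℓ ∣ λ² − λ + 1 = (−λ)² + (−λ) + 1`
      obtain ⟨a, b, hab⟩ := exists_sq_add_mul_add_sq_eq_of_dvd hℓ (x := -lam) (by convert hlam using 1; ring)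
      exact ⟨a, b, by rw [← hab]; ring⟩
  -- Step 2: adjust by conjugation
  obtain ⟨a, b, hab⟩ := h1
  have hprime : Prime (ℓ : ℤ) := Nat.prime_iff_prime_int.mp hℓ
  have hprod : (ℓ : ℤ) ∣ (a + b * (t - lam)) * (a + b * lam) := by
    have : (a + b * (t - lam)) * (a + b * lam) = (ℓ : ℤ) - b ^ 2 * (lam ^ 2 - t * lam + 1) := by rw [← hab]; ring
    rw [this]
    exact dvd_sub (dvd_refl _) (Dvd.dvd.mul_left hlam _)
  rcases hprime.dvd_or_dvd hprod with h | h
  · exact ⟨a, b, hab, h⟩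
  · refine ⟨a + t * b, -b, by rw [← hab]; ring, ?_⟩
    have heq : a + t * b + -b * (t - lam) = a + b * lam := by ring
    rw [heq]
    exact h

end Arith

/-! ## 4. Left multiplications on the quotient `M / K` of two lattices -/

section LatQuotLeft

variable {B : Type*} [Ring B] {M K : Submodule ℤ B}

/-- Left multiplication by `z` (with `zM ⊆ M`, `zK ⊆ K`) descends to an endomorphism of `M / K`; stated as an existence to keep
this file free of definitions. [folklore] -/
theorem exists_latQuot_mulLeft (z : B) (hM : ∀ x ∈ M, z * x ∈ M) (hK : ∀ x ∈ K, z * x ∈ K) :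
    ∃ L : LatQuot M K →+ LatQuot M K, ∀ x : M, L (latMk M K x) = latMk M K ⟨z * x, hM _ x.2⟩ := by
  let f : M →+ M := AddMonoidHom.mk' (fun x => ⟨z * (x : B), hM _ x.2⟩)
    (fun x y => Subtype.ext (by simp only [Submodule.coe_add, mul_add]))
  refine ⟨QuotientAddGroup.map (latRes M K) (latRes M K) f (fun x hx => ?_), fun x => ?_⟩
  · rw [AddSubgroup.mem_comap]
    exact hK _ hx
  · exact QuotientAddGroup.map_mk' _ _ _ _ x

/-- A descended left multiplication commutes with every descended right multiplication (`(z x) w = z (x w)`). [folklore] -/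
theorem actQ_mulLeft_comm {z w : B} (hMw : ∀ x ∈ M, x * w ∈ M) (hKw : ∀ x ∈ K, x * w ∈ K)
    (hM : ∀ x ∈ M, z * x ∈ M) {L : LatQuot M K →+ LatQuot M K}
    (hL : ∀ x : M, L (latMk M K x) = latMk M K ⟨z * x, hM _ x.2⟩) (y : LatQuot M K) :
    actQ w hMw hKw (L y) = L (actQ w hMw hKw y) := by
  obtain ⟨x, rfl⟩ := QuotientAddGroup.mk'_surjective (latRes M K) y
  rw [hL, actQ_mk, actQ_mk, hL]
  congr 1
  exact Subtype.ext (mul_assoc _ _ _)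

/-- For a unit `β` with `βM ⊆ M`, the subgroup `(βM ∩ M)/K = βM/K` of `M/K` is the image of `M/K` under left multiplication
by `β`. [folklore] -/
theorem subOf_units_smul_eq_map_top {β : Bˣ} (hβM : ∀ x ∈ M, (β : B) * x ∈ M) {L : LatQuot M K →+ LatQuot M K}
    (hL : ∀ x : M, L (latMk M K x) = latMk M K ⟨β * x, hβM _ x.2⟩) :
    subOf M K (β • M) = (⊤ : AddSubgroup (LatQuot M K)).map L := by
  ext y
  rw [mem_subOf, AddSubgroup.mem_map]
  constructor
  · rintro ⟨x, hx, rfl⟩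
    obtain ⟨m, hm, hxm⟩ := (Submodule.mem_smul_pointwise_iff_exists (x : B) β M).mp hx
    refine ⟨latMk M K ⟨m, hm⟩, AddSubgroup.mem_top _, ?_⟩
    rw [hL]
    congr 1
    exact Subtype.ext (by rw [← hxm, Units.smul_def, smul_eq_mul])
  · rintro ⟨v, -, rfl⟩
    obtain ⟨m, rfl⟩ := QuotientAddGroup.mk'_surjective (latRes M K) v
    refine ⟨⟨β * m, hβM _ m.2⟩, ?_, (hL m).symm⟩
    change (β : B) * m ∈ β • M
    rw [← smul_eq_mul, ← Units.smul_def]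
    exact Submodule.smul_mem_pointwise_smul _ β M m.2

end LatQuotLeft

end Summit.BirchSwinnertonDyer.BirchSwinnertonDyer.Theorems.LeafPartnerBrandt

end
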